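import Summits.CriticalPhenomena.PercolationContinuityZ3.Theorems.PercNearOneGluingNoHeavyLowerTailSahiCTCRtThreeKleitmanBulk
import HarnessLib

/-!
# `NoHeavyLowerTail` (crux stmt-CriticalPhenomena-4575), P3 lane: the KLEITMAN BULK OF CO-DIMENSION ≤ 1 as one atom sum —
# the `Θ₁` twin of `…RtThreeKleitmanBulk` (needed by the `Θ₁`-blocks of the rows with a doubled point, `…RtThreeRowOneBlocks`)

Support file (seat `prim-l12-p3`, gen 51; `--supports stmt-CriticalPhenomena-4575`).  Memo
`run/shared/lean/prim/prim-l12/FROM-prim-l12-p3-g51-ROW0-ALL-K-LEAN.md` §5.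

Verbatim twin of `…RtThreeKleitmanBulk` with `#U ≤ 2` replaced by `#U ≤ 1` (`Σ_{t<2}` instead of `Σ_{t<3}`, `1 + o` instead of `θ₂(o)`):
* `sum_range_two_choose(_indicator)`, `sepE_kleitmanBulkOne(_of)` : the type identity `sepE = [b = c = 0]·(1+o) − [a = 0]·[o ≤ 1]`;
* `card_filter_card_le_one`, `sum_small_sum_powerset_sdiffOne`, `sum_small_indicatorOne` : bookkeeping;
* **`sum_kap_eq_atomSumOne`** : `Σ_{U ⊆ V, #U ≤ 1} κ(∅, V∖U) = atomSum` with the `J`-table `(a,b,c) ↦ Σ_{t<2} C(k−a−b−c,t)·ω_{k−t}(b+c)`.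
No new definitions; nothing is asserted about the crux.
-/

noncomputable section

open scoped Classical

namespace Summit.CriticalPhenomena.PercolationContinuityZ3.Theorems.SahiCTCForms

open Finset MvPolynomial SahiCTCGenFun

/-- `#{U ⊆ W : #U ≤ 1} = 1 + #W`. [this work] -/
theorem card_filter_card_le_one {α : Type*} [DecidableEq α] (W : Finset α) : #(W.powerset.filter fun U => #U ≤ 1) = 1 + #W := by
  have hsplit : (W.powerset.filter fun U => #U ≤ 1) = powersetCard 0 W ∪ powersetCard 1 W := by
    ext U; simp only [mem_filter, mem_powerset, mem_union, mem_powersetCard]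
    by_cases hUW : U ⊆ W
    · simp only [hUW, true_and]; omega
    · simp [hUW]
  have hd01 : Disjoint (powersetCard 0 W) (powersetCard 1 W) :=
    disjoint_left.2 fun U h0 h1 => by rw [mem_powersetCard] at h0 h1; omega
  rw [hsplit, card_union_of_disjoint hd01, card_powersetCard, card_powersetCard, Nat.choose_zero_right, Nat.choose_one_right]

/-- `Σ_{t<2} C(o,t) = 1 + o`. [this work] -/
theorem sum_range_two_choose (o : ℕ) : ∑ t ∈ range 2, ((o.choose t : ℕ) : ℚ) = 1 + (o : ℚ) := by
  simp only [sum_range_succ, sum_range_zero, zero_add, Nat.choose_zero_right, Nat.choose_one_right]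
  push_cast; ring

/-- `Σ_{t<2} C(o,t)·[a + o = t] = [a = 0]·[o ≤ 1]`. [this work] -/
theorem sum_range_two_choose_indicator (o a : ℕ) :
    ∑ t ∈ range 2, ((o.choose t : ℕ) : ℚ) * (if a + o = t then 1 else 0) = (if a = 0 ∧ o ≤ 1 then 1 else 0) := by
  by_cases ha : a = 0
  · subst ha
    simp only [zero_add, true_and]
    rcases Nat.lt_or_ge o 2 with ho | ho
    · interval_cases o <;> (rw [sum_range_succ, sum_range_succ, sum_range_zero]; norm_num)
    · rw [if_neg (by omega)]
      refine sum_eq_zero fun t ht => ?_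
      rw [mem_range] at ht
      rw [if_neg (by omega), mul_zero]
  · rw [if_neg (by omega)]
    refine sum_eq_zero fun t ht => ?_
    rw [mem_range] at ht
    by_cases h : a + o = t
    · rw [if_pos h, Nat.choose_eq_zero_of_lt (by omega)]; simp
    · rw [if_neg h, mul_zero]

/-- **The type identity of the Kleitman bulk, general weights**: if `w t` is a pivotal weight on `k − t` points for `t ≤ 1`
(`r·w t s − s·w t (s−1) = [s=0] − [r=0]` whenever `r + s = k − t`), then with the `J`-table
`(a,b,c) ↦ Σ_{t<3} C(k−a−b−c, t)·w t (b+c)` and the other tables zero, `sepE(a,b,c,o) = [b = c = 0]·(1+o) − [a = 0]·[o ≤ 1]` whenever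
`a + b + c + o = k`. [this work] -/
theorem sepE_kleitmanBulkOne_of (k : ℕ) (w : ℕ → ℕ → ℚ)
    (hw : ∀ t r s : ℕ, t ≤ 1 → r + s = k - t → (r : ℚ) * w t s - (s : ℚ) * w t (s - 1) = (if s = 0 then 1 else 0) - (if r = 0 then 1 else 0))
    (a b c o : ℕ) (h : a + b + c + o = k) :
    sepE (fun a b c => ∑ t ∈ range 2, (((k - a - b - c).choose t : ℕ) : ℚ) * w t (b + c))
      (fun _ _ _ => 0) (fun _ _ _ => 0) (fun _ _ _ => 0) (fun _ _ _ => 0) a b c o =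
      (if b = 0 ∧ c = 0 then (1 + (o : ℚ)) else 0) - (if a = 0 ∧ o ≤ 1 then 1 else 0) := by
  -- the per-`t` identity
  have hWid : ∀ t, t ≤ 1 → t ≤ o → ((a : ℚ) + o - t) * w t (b + c) - ((b : ℚ) + c) * w t (b + c - 1) =
      (if b + c = 0 then 1 else 0) - (if a + o = t then 1 else 0) := by
    intro t ht2 hto
    have hid := hw t (a + o - t) (b + c) ht2 (by omega)
    have hcast : ((a + o - t : ℕ) : ℚ) = (a : ℚ) + o - t := by
      rw [Nat.cast_sub (by omega)]; push_cast; ring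
    rw [hcast] at hid
    have hiff : (a + o - t = 0) ↔ (a + o = t) := by omega
    simp only [hiff] at hid
    push_cast at hid ⊢
    exact hid
  -- the four corners (beta-reduced)
  have hC1 : (a : ℚ) * ∑ t ∈ range 2, (((k - a - b - c).choose t : ℕ) : ℚ) * w t (b + c)
      = (a : ℚ) * ∑ t ∈ range 2, ((o.choose t : ℕ) : ℚ) * w t (b + c) := by
    rw [show k - a - b - c = o by omega]
  have hC2 : (b : ℚ) * ∑ t ∈ range 2, (((k - (a + 1) - (b - 1) - c).choose t : ℕ) : ℚ) * w t (b - 1 + c)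
      = (b : ℚ) * ∑ t ∈ range 2, ((o.choose t : ℕ) : ℚ) * w t (b + c - 1) := by
    rcases Nat.eq_zero_or_pos b with hb | hb
    · subst hb; simp
    · rw [show k - (a + 1) - (b - 1) - c = o by omega, show b - 1 + c = b + c - 1 by omega]
  have hC3 : (c : ℚ) * ∑ t ∈ range 2, (((k - (a + 1) - b - (c - 1)).choose t : ℕ) : ℚ) * w t (b + (c - 1))
      = (c : ℚ) * ∑ t ∈ range 2, ((o.choose t : ℕ) : ℚ) * w t (b + c - 1) := by
    rcases Nat.eq_zero_or_pos c with hc | hc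
    · subst hc; simp
    · rw [show k - (a + 1) - b - (c - 1) = o by omega, show b + (c - 1) = b + c - 1 by omega]
  have hC4 : (o : ℚ) * ∑ t ∈ range 2, (((k - (a + 1) - b - c).choose t : ℕ) : ℚ) * w t (b + c)
      = ∑ t ∈ range 2, (((o : ℚ) - t) * ((o.choose t : ℕ) : ℚ)) * w t (b + c) := by
    rw [show k - (a + 1) - b - c = o - 1 by omega, mul_sum]
    refine sum_congr rfl fun t _ => ?_
    rw [← mul_assoc, cast_mul_choose_pred]
  have hE : sepE (fun a b c => ∑ t ∈ range 2, (((k - a - b - c).choose t : ℕ) : ℚ) * w t (b + c))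
      (fun _ _ _ => 0) (fun _ _ _ => 0) (fun _ _ _ => 0) (fun _ _ _ => 0) a b c o =
      ∑ t ∈ range 2, ((o.choose t : ℕ) : ℚ) * (((a : ℚ) + o - t) * w t (b + c) - ((b : ℚ) + c) * w t (b + c - 1)) := by
    unfold sepE
    simp only [mul_zero, add_zero, zero_add]
    rw [hC1, hC2, hC3, hC4, mul_sum, mul_sum, mul_sum, ← sum_sub_distrib, ← sum_sub_distrib, ← sum_add_distrib]
    refine sum_congr rfl fun t _ => ?_
    ring
  rw [hE]
  -- evaluate term by term: for `t ≤ o` use `hWid`, for `t > o` the binomial vanishes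
  have hterm : ∀ t ∈ range 2, ((o.choose t : ℕ) : ℚ) * (((a : ℚ) + o - t) * w t (b + c) - ((b : ℚ) + c) * w t (b + c - 1))
      = ((o.choose t : ℕ) : ℚ) * (if b + c = 0 then 1 else 0) - ((o.choose t : ℕ) : ℚ) * (if a + o = t then 1 else 0) := by
    intro t ht
    rw [mem_range] at ht
    by_cases hto : t ≤ o
    · rw [hWid t (by omega) hto]; ring
    · rw [Nat.choose_eq_zero_of_lt (by omega)]; simp
  rw [sum_congr rfl hterm, sum_sub_distrib, ← sum_mul, sum_range_two_choose, sum_range_two_choose_indicator]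
  have hbc : (b = 0 ∧ c = 0) ↔ b + c = 0 := by omega
  simp only [hbc]
  split_ifs <;> ring

/-- **The type identity of the Kleitman bulk** with the explicit Kleitman weights `ω_m(s) = 1/(m·C(m−1,s))` (`s < m`), `m = k − t`:
`sepE(a,b,c,o) = [b = c = 0]·(1+o) − [a = 0]·[o ≤ 1]` whenever `a + b + c + o = k`. [this work] -/
theorem sepE_kleitmanBulkOne (k a b c o : ℕ) (h : a + b + c + o = k) :
    sepE (fun a b c => ∑ t ∈ range 2, (((k - a - b - c).choose t : ℕ) : ℚ) *
        (if b + c < k - t then ((((k - t : ℕ) : ℚ)) * ((((k - t - 1).choose (b + c) : ℕ) : ℚ)))⁻¹ else 0))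
      (fun _ _ _ => 0) (fun _ _ _ => 0) (fun _ _ _ => 0) (fun _ _ _ => 0) a b c o =
      (if b = 0 ∧ c = 0 then (1 + (o : ℚ)) else 0) - (if a = 0 ∧ o ≤ 1 then 1 else 0) := by
  refine sepE_kleitmanBulkOne_of k (fun t s => if s < k - t then ((((k - t : ℕ) : ℚ)) * ((((k - t - 1).choose s : ℕ) : ℚ)))⁻¹ else 0)
    ?_ a b c o h
  intro t r s _ hrs
  have hid := kleitWeight_identity r s
  rw [hrs] at hid
  exact hid

/-! ### The sum of the Kleitman surpluses of the cubes of co-dimension ≤ 1 as one atom sum on `V` -/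

variable {α : Type*} [DecidableEq α]


/-- Exchange: `Σ_{U ⊆ V, #U ≤ 1} Σ_{S,S' ⊆ V∖U} f(U,S,S') = Σ_{S,S' ⊆ V} Σ_{U ⊆ V∖(S∪S'), #U ≤ 1} f(U,S,S')`. [this work] -/
theorem sum_small_sum_powerset_sdiffOne (V : Finset α) (f : Finset α → Finset α → Finset α → ℚ) :
    ∑ U ∈ V.powerset.filter (fun U => #U ≤ 1), ∑ S ∈ (V \ U).powerset, ∑ S' ∈ (V \ U).powerset, f U S S' =
      ∑ S ∈ V.powerset, ∑ S' ∈ V.powerset, ∑ U ∈ (V \ (S ∪ S')).powerset.filter (fun U => #U ≤ 1), f U S S' := by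
  -- write everything as a sum over the triples and compare the index sets
  rw [sum_sigma', sum_sigma', sum_sigma', sum_sigma']
  refine sum_bij' (fun x _ => ⟨⟨x.1.2, x.2⟩, x.1.1⟩) (fun y _ => ⟨⟨y.2, y.1.1⟩, y.1.2⟩) ?_ ?_ ?_ ?_ ?_
  · rintro ⟨⟨U, S⟩, S'⟩ hx
    simp only [mem_sigma, mem_filter, mem_powerset] at hx ⊢
    obtain ⟨⟨⟨hUV, hU2⟩, hS⟩, hS'⟩ := hx
    refine ⟨⟨fun x hx => (mem_sdiff.1 (hS hx)).1, fun x hx => (mem_sdiff.1 (hS' hx)).1⟩, ?_, hU2⟩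
    intro u hu
    rw [mem_sdiff, mem_union, not_or]
    exact ⟨hUV hu, fun h => (mem_sdiff.1 (hS h)).2 hu, fun h => (mem_sdiff.1 (hS' h)).2 hu⟩
  · rintro ⟨⟨S, S'⟩, U⟩ hy
    simp only [mem_sigma, mem_filter, mem_powerset] at hy ⊢
    obtain ⟨⟨hS, hS'⟩, hU, hU2⟩ := hy
    refine ⟨⟨⟨fun u hu => (mem_sdiff.1 (hU hu)).1, hU2⟩, fun x hx => mem_sdiff.2 ⟨hS hx, fun hxU => ?_⟩⟩,
      fun x hx => mem_sdiff.2 ⟨hS' hx, fun hxU => ?_⟩⟩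
    · exact (mem_sdiff.1 (hU hxU)).2 (mem_union_left _ hx)
    · exact (mem_sdiff.1 (hU hxU)).2 (mem_union_right _ hx)
  · rintro ⟨⟨U, S⟩, S'⟩ _; rfl
  · rintro ⟨⟨S, S'⟩, U⟩ _; rfl
  · rintro ⟨⟨U, S⟩, S'⟩ _; rfl

/-- For `S, S' ⊆ V` with `R = V ∖ (S ∪ S')`:
`Σ_{U ⊆ R, #U ≤ 1} ([S = S'] − [S ⊔ S' = V∖U]) = [S = S']·(1+#R) − [S ∩ S' = ∅]·[#R ≤ 1]`. [this work] -/
theorem sum_small_indicatorOne (V S S' : Finset α) (hS : S ⊆ V) (hS' : S' ⊆ V) :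
    ∑ U ∈ (V \ (S ∪ S')).powerset.filter (fun U => #U ≤ 1),
        ((if S = S' then (1 : ℚ) else 0) - (if Disjoint S S' ∧ S ∪ S' = V \ U then 1 else 0))
      = (if S = S' then (1 + (#(V \ (S ∪ S')) : ℚ)) else 0) - (if Disjoint S S' ∧ #(V \ (S ∪ S')) ≤ 1 then 1 else 0) := by
  rw [sum_sub_distrib]
  congr 1
  · rw [sum_const, card_filter_card_le_one, nsmul_eq_mul]
    split_ifs <;> simp
  · -- the only `U` with `S ∪ S' = V ∖ U` is `U = V ∖ (S ∪ S')`
    have hkey : ∀ U ∈ (V \ (S ∪ S')).powerset.filter (fun U => #U ≤ 1), (S ∪ S' = V \ U ↔ U = V \ (S ∪ S')) := by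
      intro U hU
      have hUR : U ⊆ V \ (S ∪ S') := mem_powerset.1 (mem_filter.1 hU).1
      constructor
      · intro h
        refine Subset.antisymm hUR fun x hx => ?_
        by_contra hxU
        have : x ∈ V \ U := mem_sdiff.2 ⟨(mem_sdiff.1 hx).1, hxU⟩
        rw [← h] at this
        exact (mem_sdiff.1 hx).2 this
      · intro h; subst h
        rw [Finset.sdiff_sdiff_eq_self (union_subset hS hS')]
    by_cases hd : Disjoint S S'
    · simp only [hd, true_and]
      by_cases h2 : #(V \ (S ∪ S')) ≤ 1
      · rw [if_pos h2]
        rw [sum_ite, sum_const_zero, add_zero, sum_const, nsmul_eq_mul, mul_one]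
        have : ((V \ (S ∪ S')).powerset.filter (fun U => #U ≤ 1)).filter (fun U => S ∪ S' = V \ U) = {V \ (S ∪ S')} := by
          ext U
          simp only [mem_filter, mem_powerset, mem_singleton]
          constructor
          · rintro ⟨⟨hU1, hU2⟩, h⟩; exact (hkey U (mem_filter.2 ⟨mem_powerset.2 hU1, hU2⟩)).1 h
          · intro h; subst h; exact ⟨⟨Subset.rfl, h2⟩, by rw [Finset.sdiff_sdiff_eq_self (union_subset hS hS')]⟩
        rw [this, card_singleton]; simp
      · rw [if_neg h2]
        refine sum_eq_zero fun U hU => ?_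
        rw [if_neg]
        intro h
        have hU' := (hkey U hU).1 h
        subst hU'
        exact h2 (mem_filter.1 hU).2
    · simp [hd]

/-- **THE KLEITMAN BULK AS ONE ATOM SUM ON `V`**: for any two families and any finset `V` (`k = #V`),
`Σ_{U ⊆ V, #U ≤ 1} κ(∅, V∖U) = atomSum` with the `J`-table `(a,b,c) ↦ Σ_{t ≤ 1} C(k−a−b−c, t)·ω_{k−t}(b+c)` and the other tables zero. [this work] -/
theorem sum_kap_eq_atomSumOne (F G : Finset (Finset α)) (V : Finset α) :
    ∑ U ∈ V.powerset.filter (fun U => #U ≤ 1), (kap F G ∅ (V \ U) : ℚ) =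
      atomSum (fun a b c => ∑ t ∈ range 2, (((#V - a - b - c).choose t : ℕ) : ℚ) *
        (if b + c < #V - t then ((((#V - t : ℕ) : ℚ)) * ((((#V - t - 1).choose (b + c) : ℕ) : ℚ)))⁻¹ else 0))
      (fun _ _ _ => 0) (fun _ _ _ => 0) (fun _ _ _ => 0) (fun _ _ _ => 0) F G V := by
  rw [atomSum_eq_sum_sepE]
  simp_rw [kap_empty_eq_sum]
  rw [sum_small_sum_powerset_sdiffOne V (fun U S S' => ιq F S * ιq G S' *
      ((if S = S' then (1 : ℚ) else 0) - (if Disjoint S S' ∧ S ∪ S' = V \ U then 1 else 0)))]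
  refine sum_congr rfl fun S hS => sum_congr rfl fun S' hS' => ?_
  have hSV : S ⊆ V := mem_powerset.1 hS
  have hS'V : S' ⊆ V := mem_powerset.1 hS'
  rw [← mul_sum, sum_small_indicatorOne V S S' hSV hS'V]
  have hsum : #(S ∩ S') + #(S \ S') + #(S' \ S) + #(V \ (S ∪ S')) = #V := by
    have h1 : #(S ∪ S') + #(S ∩ S') = #S + #S' := card_union_add_card_inter S S'
    have h2 : #(V \ (S ∪ S')) = #V - #(S ∪ S') := card_sdiff_of_subset (union_subset hSV hS'V)
    have h3 : #(S ∪ S') ≤ #V := card_le_card (union_subset hSV hS'V)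
    have h4 : #(S ∩ S') + #(S \ S') = #S := card_inter_add_card_sdiff S S'
    have h5 : #(S ∩ S') + #(S' \ S) = #S' := by rw [inter_comm]; exact card_inter_add_card_sdiff S' S
    omega
  rw [sepE_kleitmanBulkOne _ _ _ _ _ hsum]
  congr 2
  · have : (#(S \ S') = 0 ∧ #(S' \ S) = 0) ↔ S = S' := by
      rw [card_eq_zero, card_eq_zero, sdiff_eq_empty_iff_subset, sdiff_eq_empty_iff_subset]
      exact ⟨fun h => Subset.antisymm h.1 h.2, fun h => ⟨h.le, h.ge⟩⟩
    simp only [this]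
  · have : (#(S ∩ S') = 0 ∧ #(V \ (S ∪ S')) ≤ 1) ↔ (Disjoint S S' ∧ #(V \ (S ∪ S')) ≤ 1) := by
      rw [card_eq_zero, ← disjoint_iff_inter_eq_empty]
    simp only [this]


end Summit.CriticalPhenomena.PercolationContinuityZ3.Theorems.SahiCTCForms
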